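import Literature.Analysis.FluidPDE.SchefferTestFunction
import Literature.Analysis.FluidPDE.CKNLocalRegularityRRS
import HarnessLib

/-!
# The cut-off functions of Robinson–Rodrigo–Sadowski's Lemma 15.11 (discharge of `RRS2016.lemma15_11`)

Analysis/FluidPDE file in the decomposition of the named facts
`Literature.Analysis.FluidPDE.lemarieRieusset_epsilon_regularity` (Lemarié-Rieusset 2016,
Thm. 14.4) and `Literature.Analysis.FluidPDE.oneScaleRegularity` through
`RRS2016.theorem15_3_force` (`CKNLocalRegularityRRS`). It **discharges the named fact**
`RRS2016.lemma15_11` (Robinson–Rodrigo–Sadowski 2016, Lemma 15.11, pp. 230–231: the family of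
nonnegative test functions `φ_n`, `n ≥ 2`, with (i) `C₁⁻¹ r_n⁻¹ ≤ φ_n ≤ C₁ r_n⁻¹`,
`|∇φ_n| ≤ C₁ r_n⁻²` on `Q_{r_n}`, (ii) `φ_n ≤ C₁ r_n² r_k⁻³`, `|∇φ_n| ≤ C₁ r_n² r_k⁻⁴` on
`Q_{r_{k-1}} ∖ Q_{r_k}`, (iii) `supp φ_n ∩ Q_1 ⊆ Q_{1/3}`, (iv) `|∂ₜφ_n + Δφ_n| ≤ C₁ r_n²` for
`t ≤ s`): `RRS2016.lemma15_11_holds`.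

## The construction

Following the printed proof (`φ_n = r_n² χ_n ψ_n` with `ψ_n` the backward heat kernel with pole
at `(s + r_n², a)` and `χ_n` a cut-off), in the vocabulary of the tree's fully proved Scheffer
test function (`SchefferTestFunction`, Lemarié-Rieusset 2016, §13.9): for `z = (s, a)`,

  `cutoffFn n z τ y = r_n² · S(τ - s) · θ((τ - s)/(r_n/2)²) · φ_{1/2}(a - y) · W_{r_n² + s - τ}(a - y)`,

where `W` is the heat kernel (`UnboundedOperators.heatKernel`; `Scheffer.spaceFactor 1 (r_n/2) (1/2)`,
`4 (r_n/2)² = r_n²`), `φ_{1/2} = Scheffer.spaceCut (1/2)` (`= 1` on `‖w‖ ≤ 1/4`, `= 0` for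
`‖w‖ ≥ 5/16`), `θ = Scheffer.timeRamp` (`= 1` for `τ ≤ s + r_n²/4`, `= 0` for `τ ≥ s + r_n²/2`) and
`S = lowCut` (`= 0` for `τ - s ≤ -1/9`, `= 1` for `τ - s ≥ -1/16`, independent of `n`). Compared
with the printed `T_n`, the upper transition is Scheffer's ramp and the lower one is `S`; the
printed list of properties is what is proved:

* `contDiff_cutoffFn` — smooth on `ℝ × ℝ³` (the ramp vanishes before the kernel's singular
  time `s + r_n²`) with compact support; `support_cutoffFn_subset_box` (support in
  `(s - 1/9, s + r_n²/2) × B(a, 1/2)`), `support_cutoffFn_inter_subset` ((iii));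
* `bounds_core` — (i): on `Q_{r_n}(z)`, `n ≥ 2`, all cut-offs equal `1`, the variance lies in
  `(r_n², 2r_n²)`, so `(8π)^{-3/2} e^{-1/4} r_n⁻¹ ≤ φ_n ≤ (4π)^{-3/2} r_n⁻¹` and
  `‖∇φ_n‖ ≤ (4π)^{-3/2} r_n⁻²` (peak bounds `Scheffer.heatKernel_le_peak`,
  `Scheffer.norm_fderiv_heatKernel_le_peak`);
* `exists_bounds_ring` — (ii): on `Q_{r_j} ∖ Q_{r_{j+1}}` either `τ ≤ s - r_{j+1}²` (variance
  `≥ r_{j+1}²`) or `‖y - a‖ ≥ r_{j+1}` (off-diagonal bounds `Scheffer.exists_heatKernel_le_div_pow`,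
  `Scheffer.exists_norm_fderiv_heatKernel_le_div_pow`);
* `exists_abs_heat_cutoffFn_le` — (iv): below `s` the ramp is `1`, the kernel is caloric
  (`Scheffer.deriv_kernel_add_laplacian`), and the cut-off derivatives live where the kernel and
  its gradient are uniformly bounded (mirror of `Scheffer.exists_abs_heat_testFn_le`);
* `lemma15_11_holds` — the assembly with `C₁ = max(1, c_low⁻¹, c_up, C_ring, C_heat)`.

## References

* J. C. Robinson, J. L. Rodrigo, W. Sadowski, *The three-dimensional Navier–Stokes equations*,
  CUP (2016), Lemma 15.11 pp. 230–231. [RobinsonRodrigoSadowski2016]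
* P. G. Lemarié-Rieusset, *The Navier–Stokes Problem in the 21st Century* (2016), §13.9 Step 1
  (Scheffer's test function). [LemarieRieusset2016]
-/

noncomputable section

open MeasureTheory Filter Topology Set InnerProductSpace Metric Function
open scoped Real NNReal RealInnerProductSpace Laplacian ContDiff

namespace Literature.Analysis.FluidPDE

namespace RRS2016

open Scheffer UnboundedOperators

/-- Local notation for physical space `ℝ³ = EuclideanSpace ℝ (Fin 3)`. -/
local notation "ℝ³" => EuclideanSpace ℝ (Fin 3)

/-! ### The lower time cut-off -/

/-- The lower time cut-off `S(t') = smoothTransition((t' + 1/9)/(1/9 - 1/16))`: smooth, values in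
`[0, 1]`, `= 0` for `t' ≤ -1/9`, `= 1` for `t' ≥ -1/16` (the left half of RRS's `T_n`). [folklore] -/
def lowCut (t' : ℝ) : ℝ := Real.smoothTransition ((t' + 1 / 9) / (1 / 9 - 1 / 16))

/-- `S` is smooth. [folklore] -/
theorem contDiff_lowCut {m : ℕ∞} : ContDiff ℝ m lowCut :=
  Real.smoothTransition.contDiff.comp ((contDiff_id.add contDiff_const).div_const _)

/-- `S ≥ 0`. [folklore] -/
theorem lowCut_nonneg (t' : ℝ) : 0 ≤ lowCut t' := Real.smoothTransition.nonneg _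

/-- `S ≤ 1`. [folklore] -/
theorem lowCut_le_one (t' : ℝ) : lowCut t' ≤ 1 := Real.smoothTransition.le_one _

/-- `S(t') = 0` for `t' ≤ -1/9`. [folklore] -/
theorem lowCut_eq_zero {t' : ℝ} (h : t' ≤ -1 / 9) : lowCut t' = 0 :=
  Real.smoothTransition.zero_of_nonpos (div_nonpos_of_nonpos_of_nonneg (by linarith) (by norm_num))

/-- `S(t') = 1` for `t' ≥ -1/16`. [folklore] -/
theorem lowCut_eq_one {t' : ℝ} (h : -1 / 16 ≤ t') : lowCut t' = 1 :=
  Real.smoothTransition.one_of_one_le (by rw [le_div_iff₀ (by norm_num)]; linarith)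

/-- `S(t') ≠ 0` forces `-1/9 < t'`. [folklore] -/
theorem lt_of_lowCut_ne_zero {t' : ℝ} (h : lowCut t' ≠ 0) : -1 / 9 < t' :=
  lt_of_not_ge fun h' => h (lowCut_eq_zero h')

/-- Near a point with `t' > -1/16`, `S` is the constant `1`. [folklore] -/
theorem lowCut_eventuallyEq_one {t' : ℝ} (h : -1 / 16 < t') : lowCut =ᶠ[𝓝 t'] fun _ => (1 : ℝ) := by
  filter_upwards [Ioi_mem_nhds h] with σ hσ using lowCut_eq_one hσ.le

/-- Near a point with `t' < -1/9`, `S` is the constant `0`. [folklore] -/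
theorem lowCut_eventuallyEq_zero {t' : ℝ} (h : t' < -1 / 9) : lowCut =ᶠ[𝓝 t'] fun _ => (0 : ℝ) := by
  filter_upwards [Iio_mem_nhds h] with σ hσ using lowCut_eq_zero hσ.le

/-- A bound for the derivative of `S`, and where it can be non-zero. [folklore] -/
theorem exists_abs_deriv_lowCut_le :
    ∃ M : ℝ, 0 ≤ M ∧ ∀ t', |deriv lowCut t'| ≤ M ∧ (deriv lowCut t' ≠ 0 → -1 / 9 ≤ t' ∧ t' ≤ -1 / 16) := by
  have hc : Continuous (deriv lowCut) := (contDiff_lowCut (m := 1)).continuous_deriv le_rfl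
  have hzero : ∀ t', t' ∉ Icc (-1 / 9 : ℝ) (-1 / 16) → deriv lowCut t' = 0 := by
    intro t' ht'
    rw [mem_Icc, not_and_or, not_le, not_le] at ht'
    rcases ht' with h | h
    · rw [(lowCut_eventuallyEq_zero h).deriv_eq, deriv_const]
    · rw [(lowCut_eventuallyEq_one h).deriv_eq, deriv_const]
  obtain ⟨M, hM⟩ := hc.bounded_above_of_compact_support (HasCompactSupport.intro isCompact_Icc hzero)
  refine ⟨max M 0, le_max_right _ _, fun t' => ⟨(Real.norm_eq_abs _ ▸ hM t').trans (le_max_left _ _),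
    fun hne => ?_⟩⟩
  by_contra hcon
  exact hne (hzero t' (fun hmem => hcon ⟨hmem.1, hmem.2⟩))

/-! ### The cut-off function `φ_n` -/

/-- **RRS's cut-off `φ_n`** centred at `z = (s, a)`: `φ_n(τ, y) = r_n² S(τ - s) θ((τ - s)/(r_n/2)²)
φ_{1/2}(a - y) W_{r_n² + s - τ}(a - y)` with `S = lowCut`, `θ = Scheffer.timeRamp`,
`φ_{1/2} = Scheffer.spaceCut (1/2)` and the backward heat kernel (`Scheffer.spaceFactor 1 (r_n/2) (1/2)`,
`4 (r_n/2)² = r_n²`): the printed `r_n² χ_n ψ_n` of Lemma 15.11 up to the normalisation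
`(4π)^{3/2}` of the heat kernel and the particular cut-off profiles. [cite: RobinsonRodrigoSadowski2016, Lemma 15.11 pp. 230–231] -/
def cutoffFn (n : ℕ) (z : ℝ × ℝ³) (τ : ℝ) (y : ℝ³) : ℝ :=
  rad n ^ 2 * (lowCut (τ - z.1) * timeRamp ((τ - z.1) / (rad n / 2) ^ 2)) *
    spaceFactor 1 (rad n / 2) (1 / 2) z.1 τ (z.2 - y)

/-- Unfolding `cutoffFn`. [folklore] -/
theorem cutoffFn_apply (n : ℕ) (z : ℝ × ℝ³) (τ : ℝ) (y : ℝ³) :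
    cutoffFn n z τ y = rad n ^ 2 * (lowCut (τ - z.1) * timeRamp ((τ - z.1) / (rad n / 2) ^ 2)) *
      (spaceCut (1 / 2) (z.2 - y) * heatKernel (1 * (4 * (rad n / 2) ^ 2 + z.1 - τ)) (z.2 - y)) := rfl

/-- The variance of the kernel: `4 (r_n/2)² + s - τ = r_n² + s - τ`. [folklore] -/
theorem sigma_eq (n : ℕ) (s τ : ℝ) : 1 * (4 * (rad n / 2) ^ 2 + s - τ) = rad n ^ 2 + s - τ := by ring

/-- Above `s + r_n²/2` the time ramp switches `φ_n` off. [folklore] -/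
theorem cutoffFn_eq_zero_of_le {n : ℕ} {z : ℝ × ℝ³} {τ : ℝ} (h : rad n ^ 2 / 2 ≤ τ - z.1) (y : ℝ³) :
    cutoffFn n z τ y = 0 := by
  have hr := rad_pos n
  have : timeRamp ((τ - z.1) / (rad n / 2) ^ 2) = 0 :=
    timeRamp_of_two_le (by rw [le_div_iff₀ (by positivity)]; nlinarith)
  simp [cutoffFn_apply, this]

/-- Below `s + r_n²/2` the variance is positive. [folklore] -/
theorem sigma_pos' {n : ℕ} {s τ : ℝ} (h : τ - s < rad n ^ 2 / 2) : 0 < 1 * (4 * (rad n / 2) ^ 2 + s - τ) := by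
  rw [sigma_eq]; nlinarith [rad_pos n]

/-- `φ_n ≥ 0`. [cite: RobinsonRodrigoSadowski2016, Lemma 15.11 pp. 230–231] -/
theorem cutoffFn_nonneg (n : ℕ) (z : ℝ × ℝ³) (τ : ℝ) (y : ℝ³) : 0 ≤ cutoffFn n z τ y := by
  rcases le_or_gt (rad n ^ 2 / 2) (τ - z.1) with h | h
  · rw [cutoffFn_eq_zero_of_le h]
  · rw [cutoffFn_apply]
    exact mul_nonneg (mul_nonneg (by positivity) (mul_nonneg (lowCut_nonneg _) (timeRamp_nonneg _)))
      (mul_nonneg (spaceCut_nonneg _ _) (heatKernel_pos (sigma_pos' h) _).le)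

/-- **Support**: `φ_n(τ, y) ≠ 0` forces `-1/9 < τ - s < r_n²/2` and `‖y - a‖ < 5/16`. [cite: RobinsonRodrigoSadowski2016, Lemma 15.11 pp. 230–231] -/
theorem support_cutoffFn {n : ℕ} {z : ℝ × ℝ³} {τ : ℝ} {y : ℝ³} (h : cutoffFn n z τ y ≠ 0) :
    (-1 / 9 < τ - z.1 ∧ τ - z.1 < rad n ^ 2 / 2) ∧ ‖y - z.2‖ < 5 / 16 := by
  have h1 : lowCut (τ - z.1) ≠ 0 := fun h0 => h (by simp [cutoffFn_apply, h0])
  have h2 : spaceCut (1 / 2) (z.2 - y) ≠ 0 := fun h0 => h (by rw [cutoffFn_apply, h0, zero_mul, mul_zero])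
  have h3 : τ - z.1 < rad n ^ 2 / 2 := lt_of_not_ge fun h' => h (cutoffFn_eq_zero_of_le h' y)
  refine ⟨⟨lt_of_lowCut_ne_zero h1, h3⟩, ?_⟩
  have := norm_lt_of_spaceCut_ne_zero (by norm_num : (0:ℝ) < 1 / 2) h2
  rw [norm_sub_rev] at this
  linarith


/-! ### Smoothness and support -/

/-- `φ_n` is smooth on `ℝ × ℝ³` (the time ramp vanishes for `τ ≥ s + r_n²/2`, before the backward
heat kernel becomes singular at `τ = s + r_n²`) and compactly supported. [cite: RobinsonRodrigoSadowski2016, Lemma 15.11 pp. 230–231] -/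
theorem contDiff_cutoffFn (n : ℕ) (z : ℝ × ℝ³) :
    ContDiff ℝ (⊤ : ℕ∞) (uncurry (cutoffFn n z)) ∧ HasCompactSupport (uncurry (cutoffFn n z)) := by
  have hr := rad_pos n
  set K : Set (ℝ × ℝ³) := Icc (z.1 - 1 / 9) (z.1 + rad n ^ 2 / 2) ×ˢ closedBall z.2 (5 / 16) with hK
  have hKc : IsCompact K := isCompact_Icc.prod (isCompact_closedBall _ _)
  have hzero : ∀ q : ℝ × ℝ³, q ∉ K → uncurry (cutoffFn n z) q = 0 := by
    intro q hq
    by_contra h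
    obtain ⟨⟨h1, h2⟩, h3⟩ := support_cutoffFn h
    refine hq ⟨⟨by linarith, by linarith⟩, ?_⟩
    rw [mem_closedBall, dist_eq_norm]; exact h3.le
  refine ⟨?_, HasCompactSupport.intro hKc hzero⟩
  rw [contDiff_iff_contDiffAt]
  intro q
  rcases lt_or_ge q.1 (z.1 + 4 * (rad n / 2) ^ 2) with hq | hq
  · have heq : uncurry (cutoffFn n z) = fun q : ℝ × ℝ³ =>
        rad n ^ 2 * (lowCut (q.1 - z.1) * timeRamp ((q.1 - z.1) / (rad n / 2) ^ 2)) *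
          (spaceCut (1 / 2) (z.2 - q.2) * kernel 1 (rad n / 2) z.1 z.2 q.1 q.2) := rfl
    rw [heq]
    have hU : Iio (z.1 + 4 * (rad n / 2) ^ 2) ×ˢ (univ : Set ℝ³) ∈ 𝓝 q :=
      (isOpen_Iio.prod isOpen_univ).mem_nhds ⟨hq, mem_univ _⟩
    have hk : ContDiffAt ℝ ∞ (fun q : ℝ × ℝ³ => kernel 1 (rad n / 2) z.1 z.2 q.1 q.2) q :=
      (contDiffOn_uncurry_kernel one_pos (rad n / 2) z.1 z.2).contDiffAt hU
    have h1 : ContDiff ℝ ∞ (fun q : ℝ × ℝ³ => lowCut (q.1 - z.1)) :=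
      contDiff_lowCut.comp (contDiff_fst.sub contDiff_const)
    have h2 : ContDiff ℝ ∞ (fun q : ℝ × ℝ³ => timeRamp ((q.1 - z.1) / (rad n / 2) ^ 2)) :=
      contDiff_timeRamp.comp ((contDiff_fst.sub contDiff_const).div_const _)
    have h3 : ContDiff ℝ ∞ (fun q : ℝ × ℝ³ => spaceCut (1 / 2) (z.2 - q.2)) :=
      (contDiff_spaceCut _).comp (contDiff_const.sub contDiff_snd)
    exact (contDiffAt_const.mul (h1.mul h2).contDiffAt).mul (h3.contDiffAt.mul hk)
  · have hU : {q' : ℝ × ℝ³ | z.1 + rad n ^ 2 / 2 < q'.1} ∈ 𝓝 q :=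
      (isOpen_lt continuous_const continuous_fst).mem_nhds (by
        show z.1 + rad n ^ 2 / 2 < q.1
        nlinarith)
    refine (contDiffAt_const (c := (0 : ℝ))).congr_of_eventuallyEq ?_
    filter_upwards [hU] with q' hq'
    exact cutoffFn_eq_zero_of_le (by linarith [hq']) q'.2

/-- The open support of `φ_n` lies in the box `(s - 1/9, s + r_n²/2) × B(a, 1/2)`. [cite: RobinsonRodrigoSadowski2016, Lemma 15.11 pp. 230–231] -/
theorem support_cutoffFn_subset_box (n : ℕ) (z : ℝ × ℝ³) :
    support (uncurry (cutoffFn n z)) ⊆ Ioo (z.1 - 1 / 9) (z.1 + rad n ^ 2 / 2) ×ˢ ball z.2 (1 / 2) := by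
  rintro ⟨τ, y⟩ h
  obtain ⟨⟨h1, h2⟩, h3⟩ := support_cutoffFn (z := z) h
  refine ⟨⟨by linarith, by linarith⟩, ?_⟩
  rw [mem_ball, dist_eq_norm]; linarith

/-- Property (iii): `(supp φ_n) ∩ Q_1(z) ⊆ Q_{1/3}(z)`. [cite: RobinsonRodrigoSadowski2016, Lemma 15.11 (iii) p. 230] -/
theorem support_cutoffFn_inter_subset (n : ℕ) (z : ℝ × ℝ³) :
    support (uncurry (cutoffFn n z)) ∩ parabolicCylinder 1 z ⊆ parabolicCylinder (1 / 3) z := by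
  rintro ⟨τ, y⟩ ⟨h, hQ⟩
  obtain ⟨⟨h1, -⟩, h3⟩ := support_cutoffFn (z := z) h
  rw [mem_parabolicCylinder] at hQ ⊢
  refine ⟨⟨by nlinarith, hQ.1.2⟩, ?_⟩
  rw [dist_eq_norm]; linarith


/-! ### The slice gradient -/

/-- The prefactor `A(τ) = r_n² S(τ - s) θ((τ - s)/(r_n/2)²)` lies in `[0, r_n²]`. [folklore] -/
theorem prefactor_mem (n : ℕ) (z : ℝ × ℝ³) (τ : ℝ) :
    0 ≤ rad n ^ 2 * (lowCut (τ - z.1) * timeRamp ((τ - z.1) / (rad n / 2) ^ 2)) ∧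
      rad n ^ 2 * (lowCut (τ - z.1) * timeRamp ((τ - z.1) / (rad n / 2) ^ 2)) ≤ rad n ^ 2 :=
  ⟨mul_nonneg (by positivity) (mul_nonneg (lowCut_nonneg _) (timeRamp_nonneg _)),
    mul_le_of_le_one_right (by positivity)
      (mul_le_one₀ (lowCut_le_one _) (timeRamp_nonneg _) (timeRamp_le_one _))⟩

/-- `‖∇_y φ_n(τ, ·)(y)‖ ≤ r_n² ‖DΦ_τ(a - y)‖` with `Φ_τ` the spatial factor. [folklore] -/
theorem norm_fderiv_cutoffFn_le (n : ℕ) (z : ℝ × ℝ³) (τ : ℝ) (y : ℝ³) :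
    ‖fderiv ℝ (cutoffFn n z τ) y‖ ≤
      rad n ^ 2 * ‖fderiv ℝ (spaceFactor (E := ℝ³) 1 (rad n / 2) (1 / 2) z.1 τ) (z.2 - y)‖ := by
  set A := rad n ^ 2 * (lowCut (τ - z.1) * timeRamp ((τ - z.1) / (rad n / 2) ^ 2)) with hA
  obtain ⟨hA0, hA1⟩ := prefactor_mem n z τ
  have hslice : cutoffFn n z τ = fun y => A * spaceFactor 1 (rad n / 2) (1 / 2) z.1 τ (z.2 - y) := rfl
  have hΦ1 : ContDiff ℝ 1 (spaceFactor (E := ℝ³) 1 (rad n / 2) (1 / 2) z.1 τ) :=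
    contDiff_spaceFactor _ _ _ _ _
  have hdiff : DifferentiableAt ℝ (fun y => spaceFactor 1 (rad n / 2) (1 / 2) z.1 τ (z.2 - y)) y :=
    ((hΦ1.comp (contDiff_const.sub contDiff_id)).differentiable one_ne_zero) y
  rw [hslice, fderiv_const_mul hdiff, norm_smul, Real.norm_of_nonneg hA0,
    norm_fderiv_comp_sub_left hΦ1]
  exact mul_le_mul_of_nonneg_right hA1 (norm_nonneg _)

/-! ### Property (i): the two-sided bound and the gradient bound on `Q_{r_n}(z)` -/

/-- **Property (i)**: on `Q_{r_n}(z)` (for `n ≥ 2`) all cut-offs are `1`, the variance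
`σ = r_n² + s - τ` lies in `(r_n², 2r_n²)`, and the heat kernel is comparable to `r_n⁻³` with
gradient `O(r_n⁻⁴)`: `c r_n⁻¹ ≤ φ_n ≤ C r_n⁻¹`, `‖∇φ_n‖ ≤ C r_n⁻²`. [cite: RobinsonRodrigoSadowski2016, Lemma 15.11 (i) pp. 230–231] -/
theorem bounds_core {n : ℕ} (hn : 2 ≤ n) (z : ℝ × ℝ³) {w : ℝ × ℝ³}
    (hw : w ∈ parabolicCylinder (rad n) z) :
    (8 * π) ^ (-(3 : ℝ) / 2) * Real.exp (-(1 / 4)) * (rad n)⁻¹ ≤ cutoffFn n z w.1 w.2 ∧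
      cutoffFn n z w.1 w.2 ≤ (4 * π) ^ (-(3 : ℝ) / 2) * (rad n)⁻¹ ∧
      ‖fderiv ℝ (cutoffFn n z w.1) w.2‖ ≤ (4 * π) ^ (-(3 : ℝ) / 2) * ((rad n) ^ 2)⁻¹ := by
  have hr := rad_pos n
  have hr4 : rad n ≤ 1 / 4 := by rw [← rad_two]; exact rad_antitone hn
  rw [mem_parabolicCylinder] at hw
  obtain ⟨⟨hw1, hw2⟩, hw3⟩ := hw
  rw [dist_eq_norm, ← norm_sub_rev] at hw3
  set τ := w.1
  set y := w.2
  -- the cut-offs are `1`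
  have hlow : lowCut (τ - z.1) = 1 := lowCut_eq_one (by nlinarith)
  have hramp : timeRamp ((τ - z.1) / (rad n / 2) ^ 2) = 1 :=
    timeRamp_of_le_one ((div_nonpos_of_nonpos_of_nonneg (by linarith) (by positivity)).trans zero_le_one)
  have hsc : spaceCut (1 / 2) (z.2 - y) = 1 := spaceCut_eq_one (by norm_num) (by linarith)
  -- the variance
  set σ := 1 * (4 * (rad n / 2) ^ 2 + z.1 - τ) with hσdef
  have hσeq : σ = rad n ^ 2 + z.1 - τ := sigma_eq n z.1 τ
  have hσlow : rad n ^ 2 ≤ σ := by rw [hσeq]; linarith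
  have hσup : σ ≤ 2 * rad n ^ 2 := by rw [hσeq]; nlinarith
  have hσ : 0 < σ := lt_of_lt_of_le (by positivity) hσlow
  have hφ : cutoffFn n z τ y = rad n ^ 2 * heatKernel σ (z.2 - y) := by
    rw [cutoffFn_apply, hlow, hramp, hsc]; ring
  -- upper bound on the kernel
  have hGup : heatKernel σ (z.2 - y) ≤ (4 * π) ^ (-(3 : ℝ) / 2) * (rad n ^ 3)⁻¹ := by
    have := heatKernel_le_peak (by positivity) hσlow (z.2 - y)
    rw [finrank_euclideanSpace_three] at this
    refine this.trans_eq ?_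
    rw [show (-(3 : ℝ) / 2) = -((3 : ℕ) : ℝ) / 2 by norm_num, mul_sq_rpow_neg_half 3 (by positivity) hr.le]
  -- lower bound on the kernel
  have hGlow : (8 * π) ^ (-(3 : ℝ) / 2) * (rad n ^ 3)⁻¹ * Real.exp (-(1 / 4)) ≤ heatKernel σ (z.2 - y) := by
    rw [heatKernel, finrank_euclideanSpace_three]
    refine mul_le_mul ?_ ?_ (by positivity) (by positivity)
    · rw [show (-((3 : ℕ) : ℝ) / 2) = -(3 : ℝ) / 2 by norm_num]
      have e : (8 * π) ^ (-(3 : ℝ) / 2) * (rad n ^ 3)⁻¹ = (4 * π * (2 * rad n ^ 2)) ^ (-(3 : ℝ) / 2) := by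
        rw [show 4 * π * (2 * rad n ^ 2) = (8 * π) * rad n ^ 2 by ring,
          show (-(3 : ℝ) / 2) = -((3 : ℕ) : ℝ) / 2 by norm_num, mul_sq_rpow_neg_half 3 (by positivity) hr.le]
      rw [e]
      exact Real.rpow_le_rpow_of_nonpos (by positivity) (by nlinarith [Real.pi_pos]) (by norm_num)
    · refine Real.exp_le_exp.2 ?_
      rw [neg_div, neg_le_neg_iff, div_le_iff₀ (by positivity)]
      have h1 : ‖z.2 - y‖ ^ 2 ≤ rad n ^ 2 := pow_le_pow_left₀ (norm_nonneg _) hw3.le 2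
      nlinarith
  refine ⟨?_, ?_, ?_⟩
  · rw [hφ]
    calc (8 * π) ^ (-(3 : ℝ) / 2) * Real.exp (-(1 / 4)) * (rad n)⁻¹
        = rad n ^ 2 * ((8 * π) ^ (-(3 : ℝ) / 2) * (rad n ^ 3)⁻¹ * Real.exp (-(1 / 4))) := by
          field_simp
      _ ≤ rad n ^ 2 * heatKernel σ (z.2 - y) := mul_le_mul_of_nonneg_left hGlow (by positivity)
  · rw [hφ]
    calc rad n ^ 2 * heatKernel σ (z.2 - y) ≤ rad n ^ 2 * ((4 * π) ^ (-(3 : ℝ) / 2) * (rad n ^ 3)⁻¹) :=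
          mul_le_mul_of_nonneg_left hGup (by positivity)
      _ = (4 * π) ^ (-(3 : ℝ) / 2) * (rad n)⁻¹ := by field_simp
  · refine (norm_fderiv_cutoffFn_le n z τ y).trans ?_
    -- on the small cylinder the cut-off is locally `1`
    have hDsc : fderiv ℝ (spaceCut (E := ℝ³) (1 / 2)) (z.2 - y) = 0 := by
      rw [(spaceCut_eventuallyEq_one (by norm_num) (by linarith)).fderiv_eq, fderiv_const_apply]
    have hDG : ‖fderiv ℝ (heatKernel σ) (z.2 - y)‖ ≤ (4 * π) ^ (-(3 : ℝ) / 2) * (rad n ^ 3)⁻¹ * (rad n)⁻¹ := by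
      have := norm_fderiv_heatKernel_le_peak (by positivity) hσlow (z.2 - y)
      rw [finrank_euclideanSpace_three, Real.sqrt_sq hr.le] at this
      refine this.trans_eq ?_
      rw [show (-((3 : ℕ) : ℝ) / 2) = -((3 : ℕ) : ℝ) / 2 from rfl,
        show (-(3 : ℝ) / 2) = -((3 : ℕ) : ℝ) / 2 by norm_num, mul_sq_rpow_neg_half 3 (by positivity) hr.le]
    rw [fderiv_spaceFactor, hDsc, smul_zero, add_zero, norm_smul, Real.norm_of_nonneg (spaceCut_nonneg _ _),
      hsc, one_mul]
    calc rad n ^ 2 * ‖fderiv ℝ (heatKernel σ) (z.2 - y)‖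
        ≤ rad n ^ 2 * ((4 * π) ^ (-(3 : ℝ) / 2) * (rad n ^ 3)⁻¹ * (rad n)⁻¹) :=
          mul_le_mul_of_nonneg_left hDG (by positivity)
      _ = (4 * π) ^ (-(3 : ℝ) / 2) * (rad n ^ 2)⁻¹ := by field_simp


/-! ### Property (ii): the bounds on the rings `Q_{r_j} ∖ Q_{r_{j+1}}` -/

/-- `φ_n ≤ r_n² W_σ(a - y)` everywhere below `s + r_n²/2` (cut-offs `≤ 1`). [folklore] -/
theorem cutoffFn_le_sq_mul_heatKernel (n : ℕ) (z : ℝ × ℝ³) {τ : ℝ} (hτ : τ - z.1 < rad n ^ 2 / 2) (y : ℝ³) :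
    cutoffFn n z τ y ≤ rad n ^ 2 * heatKernel (1 * (4 * (rad n / 2) ^ 2 + z.1 - τ)) (z.2 - y) := by
  obtain ⟨hA0, hA1⟩ := prefactor_mem n z τ
  have hG := (heatKernel_pos (sigma_pos' hτ) (z.2 - y)).le
  rw [cutoffFn_apply]
  calc _ ≤ rad n ^ 2 * (1 * heatKernel (1 * (4 * (rad n / 2) ^ 2 + z.1 - τ)) (z.2 - y)) :=
        mul_le_mul hA1 (mul_le_mul_of_nonneg_right (spaceCut_le_one _ _) hG)
          (mul_nonneg (spaceCut_nonneg _ _) hG) (by positivity)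
    _ = _ := by rw [one_mul]

/-- **Property (ii)**: on `Q_{r_j}(z) ∖ Q_{r_{j+1}}(z)` either `τ ≤ s - r_{j+1}²` (variance
`≥ r_{j+1}²`, peak bounds) or `‖y - a‖ ≥ r_{j+1}` (off-diagonal Gaussian bounds), whence
`φ_n ≤ C r_n² r_{j+1}⁻³` and `‖∇φ_n‖ ≤ C r_n² r_{j+1}⁻⁴`. [cite: RobinsonRodrigoSadowski2016, Lemma 15.11 (ii) pp. 230–231] -/
theorem exists_bounds_ring :
    ∃ C : ℝ, 0 < C ∧ ∀ (n : ℕ) (z : ℝ × ℝ³) (j : ℕ), j + 1 ≤ n →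
      ∀ w ∈ parabolicCylinder (rad j) z \ parabolicCylinder (rad (j + 1)) z,
        cutoffFn n z w.1 w.2 ≤ C * rad n ^ 2 * (rad (j + 1) ^ 3)⁻¹ ∧
        ‖fderiv ℝ (cutoffFn n z w.1) w.2‖ ≤ C * rad n ^ 2 * (rad (j + 1) ^ 4)⁻¹ := by
  obtain ⟨C₀, hC₀0, hC₀⟩ := exists_heatKernel_le_div_pow (E := ℝ³)
  obtain ⟨C₁, hC₁0, hC₁⟩ := exists_norm_fderiv_heatKernel_le_div_pow (E := ℝ³)
  obtain ⟨M, hM0, hM⟩ := exists_norm_fderiv_spaceCut_le (E := ℝ³)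
  set P : ℝ := (4 * π) ^ (-(3 : ℝ) / 2) with hP
  have hP0 : 0 < P := by positivity
  have hPeq : (4 * π) ^ (-((3 : ℕ) : ℝ) / 2) = P := by rw [hP]; norm_num
  refine ⟨(P + C₀) + (P + C₁) + 2 * M * (P + C₀) + 1, by positivity, fun n z j hjn w hw => ?_⟩
  have hr := rad_pos n
  have hrj := rad_pos (j + 1)
  have hrj1 : rad (j + 1) ≤ 1 := rad_le_one _
  obtain ⟨hw, hw'⟩ := hw
  rw [mem_parabolicCylinder] at hw hw'
  obtain ⟨⟨hw1, hw2⟩, hw3⟩ := hw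
  set τ := w.1
  set y := w.2
  have hτ : τ - z.1 < rad n ^ 2 / 2 := by nlinarith
  set σ := 1 * (4 * (rad n / 2) ^ 2 + z.1 - τ) with hσdef
  have hσeq : σ = rad n ^ 2 + z.1 - τ := sigma_eq n z.1 τ
  have hσ : 0 < σ := sigma_pos' hτ
  -- the alternative
  have halt : rad (j + 1) ^ 2 ≤ σ ∨ rad (j + 1) ≤ ‖z.2 - y‖ := by
    by_cases h1 : rad (j + 1) ≤ dist y z.2
    · right; rwa [dist_eq_norm, ← norm_sub_rev] at h1
    · left
      have h2 : ¬ (z.1 - rad (j + 1) ^ 2 < τ) := fun h => hw' ⟨⟨h, hw2⟩, not_le.1 h1⟩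
      have h3 := not_lt.1 h2
      have h4 : 0 ≤ rad n ^ 2 := sq_nonneg _
      rw [hσeq]; linarith
  -- kernel bounds
  have hK : heatKernel σ (z.2 - y) ≤ (P + C₀) * (rad (j + 1) ^ 3)⁻¹ := by
    rcases halt with h | h
    · have := heatKernel_le_peak (by positivity) h (z.2 - y)
      rw [finrank_euclideanSpace_three] at this
      refine this.trans ?_
      rw [mul_sq_rpow_neg_half 3 (by positivity) hrj.le, hPeq]
      exact mul_le_mul_of_nonneg_right (by linarith) (by positivity)
    · have := hC₀ σ (rad (j + 1)) (z.2 - y) hσ hrj h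
      rw [finrank_euclideanSpace_three] at this
      refine this.trans ?_
      rw [div_eq_mul_inv]
      exact mul_le_mul_of_nonneg_right (by linarith) (by positivity)
  have hDK : ‖fderiv ℝ (heatKernel σ) (z.2 - y)‖ ≤ (P + C₁) * (rad (j + 1) ^ 4)⁻¹ := by
    rcases halt with h | h
    · have := norm_fderiv_heatKernel_le_peak (by positivity) h (z.2 - y)
      rw [finrank_euclideanSpace_three, Real.sqrt_sq hrj.le] at this
      refine this.trans ?_
      rw [mul_sq_rpow_neg_half 3 (by positivity) hrj.le, hPeq,
        show P * (rad (j + 1) ^ 3)⁻¹ * (rad (j + 1))⁻¹ = P * (rad (j + 1) ^ 4)⁻¹ by field_simp]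
      exact mul_le_mul_of_nonneg_right (by linarith) (by positivity)
    · have := hC₁ σ (rad (j + 1)) (z.2 - y) hσ hrj h
      rw [finrank_euclideanSpace_three] at this
      refine this.trans ?_
      rw [div_eq_mul_inv]
      exact mul_le_mul_of_nonneg_right (by linarith) (by positivity)
  have h34 : (rad (j + 1) ^ 3)⁻¹ ≤ (rad (j + 1) ^ 4)⁻¹ :=
    inv_anti₀ (by positivity) (by
      calc rad (j + 1) ^ 4 = rad (j + 1) ^ 3 * rad (j + 1) := by ring
        _ ≤ rad (j + 1) ^ 3 * 1 := mul_le_mul_of_nonneg_left hrj1 (by positivity)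
        _ = rad (j + 1) ^ 3 := mul_one _)
  refine ⟨?_, ?_⟩
  · refine (cutoffFn_le_sq_mul_heatKernel n z hτ y).trans ?_
    have hcoef : P + C₀ ≤ (P + C₀) + (P + C₁) + 2 * M * (P + C₀) + 1 := by
      nlinarith [mul_nonneg hM0 (by positivity : (0:ℝ) ≤ P + C₀)]
    calc rad n ^ 2 * heatKernel σ (z.2 - y) ≤ rad n ^ 2 * ((P + C₀) * (rad (j + 1) ^ 3)⁻¹) :=
          mul_le_mul_of_nonneg_left hK (by positivity)
      _ ≤ rad n ^ 2 * (((P + C₀) + (P + C₁) + 2 * M * (P + C₀) + 1) * (rad (j + 1) ^ 3)⁻¹) :=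
          mul_le_mul_of_nonneg_left (mul_le_mul_of_nonneg_right hcoef (by positivity)) (by positivity)
      _ = _ := by ring
  · refine (norm_fderiv_cutoffFn_le n z τ y).trans ?_
    have hDΦ : ‖fderiv ℝ (spaceFactor (E := ℝ³) 1 (rad n / 2) (1 / 2) z.1 τ) (z.2 - y)‖ ≤
        (P + C₁) * (rad (j + 1) ^ 4)⁻¹ + (P + C₀) * (rad (j + 1) ^ 3)⁻¹ * (M / (1 / 2)) := by
      rw [fderiv_spaceFactor]
      refine (norm_add_le _ _).trans (add_le_add ?_ ?_)
      · rw [norm_smul, Real.norm_of_nonneg (spaceCut_nonneg _ _)]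
        exact (mul_le_of_le_one_left (norm_nonneg _) (spaceCut_le_one _ _)).trans hDK
      · rw [norm_smul, Real.norm_of_nonneg (heatKernel_pos hσ _).le]
        exact mul_le_mul hK (hM (1 / 2) (by norm_num) _).1 (norm_nonneg _) (by positivity)
    calc rad n ^ 2 * ‖fderiv ℝ (spaceFactor (E := ℝ³) 1 (rad n / 2) (1 / 2) z.1 τ) (z.2 - y)‖
        ≤ rad n ^ 2 * ((P + C₁) * (rad (j + 1) ^ 4)⁻¹ + (P + C₀) * (rad (j + 1) ^ 3)⁻¹ * (M / (1 / 2))) :=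
          mul_le_mul_of_nonneg_left hDΦ (by positivity)
      _ ≤ rad n ^ 2 * ((P + C₁) * (rad (j + 1) ^ 4)⁻¹ + (P + C₀) * (rad (j + 1) ^ 4)⁻¹ * (M / (1 / 2))) := by
          gcongr
      _ = ((P + C₁) + 2 * M * (P + C₀)) * rad n ^ 2 * (rad (j + 1) ^ 4)⁻¹ := by ring
      _ ≤ _ := by
          have hcoef : (P + C₁) + 2 * M * (P + C₀) ≤ (P + C₀) + (P + C₁) + 2 * M * (P + C₀) + 1 := by
            linarith
          exact mul_le_mul_of_nonneg_right (mul_le_mul_of_nonneg_right hcoef (sq_nonneg _))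
            (by positivity)


/-! ### Property (iv): the backward heat operator applied to `φ_n` -/

set_option maxHeartbeats 1600000 in
/-- **Property (iv)**: `|∂_τ φ_n + Δ_y φ_n| ≤ C r_n²` for `τ ≤ s` and all `y`. Below `s` the time
ramp is `1`, the backward heat kernel `K` is caloric (`∂_τ K + Δ_y K = 0`), and what is left,
`r_n² [S'(τ - s) φ_{1/2} K + S(τ - s) (K Δφ_{1/2} + 2 ∇φ_{1/2} · ∇K)]`, lives where a derivative of a
cut-off is non-zero: `S' ≠ 0` forces `s - τ ≥ 1/16` (variance `≥ 1/16`, `K ≤ (π/4)^{-3/2}`), and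
`∇φ_{1/2}, Δφ_{1/2} ≠ 0` force `‖a - y‖ ≥ 1/4` (off-diagonal Gaussian bounds). Mirror of the tree's
`Scheffer.exists_abs_heat_testFn_le`. [cite: RobinsonRodrigoSadowski2016, Lemma 15.11 (iv) pp. 230–231] -/
theorem exists_abs_heat_cutoffFn_le :
    ∃ C : ℝ, 0 ≤ C ∧ ∀ (n : ℕ) (z : ℝ × ℝ³) (τ : ℝ) (y : ℝ³), τ ≤ z.1 →
      |timeDeriv (cutoffFn n z) τ y + (Δ (cutoffFn n z τ)) y| ≤ C * rad n ^ 2 := by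
  obtain ⟨Ml, hMl0, hMl⟩ := exists_abs_deriv_lowCut_le
  obtain ⟨M₁, hM₁0, hM₁⟩ := exists_norm_fderiv_spaceCut_le (E := ℝ³)
  obtain ⟨M₂, hM₂0, hM₂⟩ := exists_abs_laplacian_spaceCut_le (E := ℝ³)
  obtain ⟨C₀, hC₀0, hC₀⟩ := exists_heatKernel_le_div_pow (E := ℝ³)
  obtain ⟨C₁, hC₁0, hC₁⟩ := exists_norm_fderiv_heatKernel_le_div_pow (E := ℝ³)
  set P₁ : ℝ := (4 * π * (1 / 16)) ^ (-(3 : ℝ) / 2) with hP₁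
  have hP₁0 : 0 ≤ P₁ := by positivity
  refine ⟨Ml * P₁ + (C₀ / (1 / 4) ^ 3 * (M₂ / (1 / 2) ^ 2) + 2 * (M₁ / (1 / 2) * (C₁ / (1 / 4) ^ 4))),
    by positivity, fun n z τ y hτ => ?_⟩
  set t := z.1 with ht
  set x := z.2 with hx
  set r : ℝ := rad n / 2 with hrdef
  have hr : 0 < r := by rw [hrdef]; linarith [rad_pos n]
  have hρ : (0 : ℝ) < 1 / 2 := by norm_num
  have hσ : 0 < (1 : ℝ) * (4 * r ^ 2 + t - τ) := by nlinarith
  set b := stdOrthonormalBasis ℝ ℝ³ with hb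
  -- Step 1: the time derivative (the ramp is `1` below `t + r²`)
  have hramp : ∀ s', s' < t + r ^ 2 → timeRamp ((s' - t) / r ^ 2) = 1 := fun s' hs' =>
    timeRamp_of_le_one (by rw [div_le_one (by positivity)]; linarith)
  have hF : (fun s' => cutoffFn n z s' y) =ᶠ[𝓝 τ]
      fun s' => rad n ^ 2 * (lowCut (s' - t) * (spaceCut (1 / 2) (x - y) * kernel 1 r t x s' y)) := by
    filter_upwards [Iio_mem_nhds (show τ < t + r ^ 2 by nlinarith)] with s' hs'
    rw [cutoffFn_apply, ← hrdef, hramp s' hs', kernel_apply]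
    ring
  have hlc_deriv : HasDerivAt (fun s' => lowCut (s' - t)) (deriv lowCut (τ - t)) τ := by
    have hin : HasDerivAt (fun s' => s' - t) 1 τ := (hasDerivAt_id τ).sub_const t
    have hout : HasDerivAt lowCut (deriv lowCut (τ - t)) (τ - t) :=
      (((contDiff_lowCut (m := 1)).differentiable one_ne_zero) _).hasDerivAt
    have h := hout.comp τ hin
    rw [mul_one] at h
    exact h
  have hK := hasDerivAt_kernel hσ x y
  have hderiv : timeDeriv (cutoffFn n z) τ y =
      rad n ^ 2 * (deriv lowCut (τ - t) * (spaceCut (1 / 2) (x - y) * heatKernel (1 * (4 * r ^ 2 + t - τ)) (x - y)) +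
        lowCut (τ - t) * (spaceCut (1 / 2) (x - y) * ((‖x - y‖ ^ 2 / (4 * (1 * (4 * r ^ 2 + t - τ)) ^ 2) - (Module.finrank ℝ ℝ³ : ℝ) / (2 * (1 * (4 * r ^ 2 + t - τ)))) * heatKernel (1 * (4 * r ^ 2 + t - τ)) (x - y) * (-1)))) := by
    rw [timeDeriv, hF.deriv_eq]
    exact ((hlc_deriv.mul (hK.const_mul (spaceCut (1 / 2) (x - y)))).const_mul (rad n ^ 2)).deriv
  -- Step 2: the Laplacian of the slice
  have hslice : cutoffFn n z τ = (rad n ^ 2 * lowCut (τ - t)) • fun y' => spaceFactor 1 r (1 / 2) t τ (x - y') := by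
    funext y'
    rw [Pi.smul_apply, smul_eq_mul, cutoffFn_apply, ← hrdef, hramp τ (by nlinarith), mul_one, spaceFactor]
  have hΦ2 : ContDiff ℝ 2 (spaceFactor (E := ℝ³) 1 r (1 / 2) t τ) := contDiff_spaceFactor _ _ _ _ _
  have hcomp2 : ContDiffAt ℝ 2 (fun y' => spaceFactor 1 r (1 / 2) t τ (x - y')) y :=
    (hΦ2.comp (contDiff_const.sub contDiff_id)).contDiffAt
  have hlap : (Δ (cutoffFn n z τ)) y =
      rad n ^ 2 * lowCut (τ - t) * (spaceCut (1 / 2) (x - y) * ((‖x - y‖ ^ 2 / (4 * (1 * (4 * r ^ 2 + t - τ)) ^ 2) - (Module.finrank ℝ ℝ³ : ℝ) / (2 * (1 * (4 * r ^ 2 + t - τ)))) * heatKernel (1 * (4 * r ^ 2 + t - τ)) (x - y)) + heatKernel (1 * (4 * r ^ 2 + t - τ)) (x - y) * (Δ (spaceCut (E := ℝ³) (1 / 2))) (x - y) + 2 * (∑ i, fderiv ℝ (spaceCut (E := ℝ³) (1 / 2)) (x - y) (b i) * fderiv ℝ (heatKernel (1 * (4 * r ^ 2 + t - τ))) (x -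 y) (b i))) := by
    rw [hslice, laplacian_smul (rad n ^ 2 * lowCut (τ - t)) hcomp2, smul_eq_mul,
      laplacian_comp_sub_left hΦ2 x y, spaceFactor_def,
      laplacian_mul_eq b (contDiff_spaceCut (1 / 2)) (contDiff_heatKernel _) (x - y), laplacian_heatKernel]
  -- Step 3: combine; the caloric terms cancel
  have hsum : timeDeriv (cutoffFn n z) τ y + (Δ (cutoffFn n z τ)) y =
      rad n ^ 2 * (deriv lowCut (τ - t) * (spaceCut (1 / 2) (x - y) * heatKernel (1 * (4 * r ^ 2 + t - τ)) (x - y)) +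
        lowCut (τ - t) * (heatKernel (1 * (4 * r ^ 2 + t - τ)) (x - y) * (Δ (spaceCut (E := ℝ³) (1 / 2))) (x - y) + 2 * (∑ i, fderiv ℝ (spaceCut (E := ℝ³) (1 / 2)) (x - y) (b i) * fderiv ℝ (heatKernel (1 * (4 * r ^ 2 + t - τ))) (x - y) (b i)))) := by
    rw [hderiv, hlap]; ring
  -- Step 4: bounds on the three remaining terms
  have hsc0 : 0 ≤ spaceCut (1 / 2) (x - y) := spaceCut_nonneg _ _
  have hsc1 : spaceCut (1 / 2) (x - y) ≤ 1 := spaceCut_le_one _ _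
  have hlc0 : 0 ≤ lowCut (τ - t) := lowCut_nonneg _
  have hlc1 : lowCut (τ - t) ≤ 1 := lowCut_le_one _
  have hG0 : 0 ≤ heatKernel (1 * (4 * r ^ 2 + t - τ)) (x - y) := (heatKernel_pos hσ _).le
  -- (a) the lower time cut-off term lives where `t - τ ≥ 1/16`
  have ha : |deriv lowCut (τ - t)| * heatKernel (1 * (4 * r ^ 2 + t - τ)) (x - y) ≤ Ml * P₁ := by
    rcases eq_or_ne (deriv lowCut (τ - t)) 0 with h0 | h0
    · rw [h0, abs_zero, zero_mul]; positivity
    · obtain ⟨-, h1⟩ := (hMl (τ - t)).2 h0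
      have hσ0 : (1 : ℝ) / 16 ≤ 1 * (4 * r ^ 2 + t - τ) := by nlinarith
      have hGle : heatKernel (1 * (4 * r ^ 2 + t - τ)) (x - y) ≤ P₁ := by
        have := heatKernel_le_peak (by norm_num) hσ0 (x - y)
        rw [finrank_euclideanSpace_three] at this
        refine this.trans_eq ?_
        rw [hP₁]; norm_num
      exact mul_le_mul (hMl _).1 hGle hG0 hMl0
  -- (b) the Laplacian of the space cut-off lives on `1/4 ≤ ‖x - y‖`
  have hb' : heatKernel (1 * (4 * r ^ 2 + t - τ)) (x - y) * |(Δ (spaceCut (E := ℝ³) (1 / 2))) (x - y)| ≤ C₀ / (1 / 4) ^ 3 * (M₂ / (1 / 2) ^ 2) := by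
    rcases eq_or_ne ((Δ (spaceCut (E := ℝ³) (1 / 2))) (x - y)) 0 with h0 | h0
    · rw [h0, abs_zero, mul_zero]; positivity
    · obtain ⟨hw1, -⟩ := (hM₂ (1 / 2) hρ (x - y)).2 h0
      have hGle : heatKernel (1 * (4 * r ^ 2 + t - τ)) (x - y) ≤ C₀ / (1 / 4) ^ 3 := by
        have := hC₀ _ (1 / 4) (x - y) hσ (by norm_num) (by linarith)
        rwa [finrank_euclideanSpace_three] at this
      exact mul_le_mul hGle (hM₂ (1 / 2) hρ (x - y)).1 (abs_nonneg _) (by positivity)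
  -- (c) so does the gradient of the space cut-off
  have hc' : |(∑ i, fderiv ℝ (spaceCut (E := ℝ³) (1 / 2)) (x - y) (b i) * fderiv ℝ (heatKernel (1 * (4 * r ^ 2 + t - τ))) (x - y) (b i))| ≤ M₁ / (1 / 2) * (C₁ / (1 / 4) ^ 4) := by
    have hCS := abs_sum_fderiv_mul_fderiv_le b (spaceCut (E := ℝ³) (1 / 2)) (heatKernel (1 * (4 * r ^ 2 + t - τ))) (x - y)
    rcases eq_or_ne (fderiv ℝ (spaceCut (E := ℝ³) (1 / 2)) (x - y)) 0 with h0 | h0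
    · refine hCS.trans ?_
      rw [h0, norm_zero, zero_mul]; positivity
    · obtain ⟨hw1, -⟩ := (hM₁ (1 / 2) hρ (x - y)).2 h0
      have hDG : ‖fderiv ℝ (heatKernel (1 * (4 * r ^ 2 + t - τ))) (x - y)‖ ≤ C₁ / (1 / 4) ^ 4 := by
        have := hC₁ _ (1 / 4) (x - y) hσ (by norm_num) (by linarith)
        rwa [finrank_euclideanSpace_three] at this
      exact hCS.trans (mul_le_mul (hM₁ (1 / 2) hρ (x - y)).1 hDG (norm_nonneg _) (by positivity))
  -- assemble
  set T₁ := deriv lowCut (τ - t) * (spaceCut (1 / 2) (x - y) * heatKernel (1 * (4 * r ^ 2 + t - τ)) (x - y)) with hT₁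
  set T₂ := heatKernel (1 * (4 * r ^ 2 + t - τ)) (x - y) * (Δ (spaceCut (E := ℝ³) (1 / 2))) (x - y) with hT₂
  set T₃ := ∑ i, fderiv ℝ (spaceCut (E := ℝ³) (1 / 2)) (x - y) (b i) * fderiv ℝ (heatKernel (1 * (4 * r ^ 2 + t - τ))) (x - y) (b i) with hT₃
  have h1 : |T₁| ≤ Ml * P₁ := by
    rw [hT₁, abs_mul, abs_mul, abs_of_nonneg hsc0, abs_of_nonneg hG0]
    calc |deriv lowCut (τ - t)| * (spaceCut (1 / 2) (x - y) * heatKernel (1 * (4 * r ^ 2 + t - τ)) (x - y))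
        ≤ |deriv lowCut (τ - t)| * (1 * heatKernel (1 * (4 * r ^ 2 + t - τ)) (x - y)) := by gcongr
      _ = |deriv lowCut (τ - t)| * heatKernel (1 * (4 * r ^ 2 + t - τ)) (x - y) := by ring
      _ ≤ Ml * P₁ := ha
  have h2 : |T₂| ≤ C₀ / (1 / 4) ^ 3 * (M₂ / (1 / 2) ^ 2) := by
    rw [hT₂, abs_mul, abs_of_nonneg hG0]; exact hb'
  have h23 : |lowCut (τ - t) * (T₂ + 2 * T₃)| ≤ C₀ / (1 / 4) ^ 3 * (M₂ / (1 / 2) ^ 2) + 2 * (M₁ / (1 / 2) * (C₁ / (1 / 4) ^ 4)) := by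
    rw [abs_mul, abs_of_nonneg hlc0]
    calc lowCut (τ - t) * |T₂ + 2 * T₃| ≤ 1 * |T₂ + 2 * T₃| := mul_le_mul_of_nonneg_right hlc1 (abs_nonneg _)
      _ = |T₂ + 2 * T₃| := one_mul _
      _ ≤ |T₂| + |2 * T₃| := abs_add_le _ _
      _ = |T₂| + 2 * |T₃| := by rw [show |2 * T₃| = 2 * |T₃| by rw [abs_mul, abs_two]]
      _ ≤ _ := add_le_add h2 (mul_le_mul_of_nonneg_left hc' (by norm_num))
  rw [hsum, abs_mul, abs_of_nonneg (by positivity : (0:ℝ) ≤ rad n ^ 2), mul_comm]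
  refine mul_le_mul_of_nonneg_right ?_ (by positivity)
  calc |T₁ + lowCut (τ - t) * (T₂ + 2 * T₃)| ≤ |T₁| + |lowCut (τ - t) * (T₂ + 2 * T₃)| := abs_add_le _ _
    _ ≤ Ml * P₁ + (C₀ / (1 / 4) ^ 3 * (M₂ / (1 / 2) ^ 2) + 2 * (M₁ / (1 / 2) * (C₁ / (1 / 4) ^ 4))) :=
        add_le_add h1 h23


/-! ### Assembly: Lemma 15.11 -/

/-- **Robinson–Rodrigo–Sadowski's Lemma 15.11, proved**: the named fact `RRS2016.lemma15_11` holds,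
with `φ_n = cutoffFn n z` and one constant `C₁ ≥ 1` collecting the constants of properties
(i), (ii), (iv). [cite: RobinsonRodrigoSadowski2016, Lemma 15.11 pp. 230–231] -/
theorem lemma15_11_holds : lemma15_11 := by
  obtain ⟨Cr, hCr0, hCr⟩ := exists_bounds_ring
  obtain ⟨Ch, hCh0, hCh⟩ := exists_abs_heat_cutoffFn_le
  set clow : ℝ := (8 * π) ^ (-(3 : ℝ) / 2) * Real.exp (-(1 / 4)) with hclow
  set cup : ℝ := (4 * π) ^ (-(3 : ℝ) / 2) with hcup
  have hclow0 : 0 < clow := by positivity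
  set C : ℝ := max 1 (max (max clow⁻¹ cup) (max Cr Ch)) with hC
  have hC1 : 1 ≤ C := le_max_left _ _
  have hC0 : 0 < C := lt_of_lt_of_le one_pos hC1
  have hClow : clow⁻¹ ≤ C := ((le_max_left _ _).trans (le_max_left _ _)).trans (le_max_right _ _)
  have hCup : cup ≤ C := ((le_max_right _ _).trans (le_max_left _ _)).trans (le_max_right _ _)
  have hCr' : Cr ≤ C := ((le_max_left _ _).trans (le_max_right _ _)).trans (le_max_right _ _)
  have hCh' : Ch ≤ C := ((le_max_right _ _).trans (le_max_right _ _)).trans (le_max_right _ _)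
  refine ⟨C, hC1, fun z n hn => ⟨cutoffFn n z, (contDiff_cutoffFn n z).1, (contDiff_cutoffFn n z).2,
    cutoffFn_nonneg n z, support_cutoffFn_subset_box n z, fun w hw => ?_, fun j _ hjn w hw => ?_,
    support_cutoffFn_inter_subset n z, fun t ht x => (hCh n z t x ht).trans ?_⟩⟩
  · obtain ⟨h1, h2, h3⟩ := bounds_core hn z hw
    have hr := rad_pos n
    refine ⟨?_, h2.trans (mul_le_mul_of_nonneg_right hCup (by positivity)), ?_⟩
    · calc C⁻¹ * (rad n)⁻¹ ≤ clow * (rad n)⁻¹ := by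
            refine mul_le_mul_of_nonneg_right ?_ (by positivity)
            calc C⁻¹ ≤ (clow⁻¹)⁻¹ := inv_anti₀ (inv_pos.2 hclow0) hClow
              _ = clow := inv_inv _
        _ ≤ cutoffFn n z w.1 w.2 := h1
    · rw [norm_gradient_eq_norm_fderiv]
      exact h3.trans (mul_le_mul_of_nonneg_right hCup (by positivity))
  · obtain ⟨h1, h2⟩ := hCr n z j hjn w hw
    have hrj := rad_pos (j + 1)
    refine ⟨h1.trans ?_, ?_⟩
    · exact mul_le_mul_of_nonneg_right (mul_le_mul_of_nonneg_right hCr' (sq_nonneg _))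
        (inv_nonneg.2 (pow_nonneg hrj.le 3))
    · rw [norm_gradient_eq_norm_fderiv]
      exact h2.trans (mul_le_mul_of_nonneg_right (mul_le_mul_of_nonneg_right hCr' (sq_nonneg _))
        (inv_nonneg.2 (pow_nonneg hrj.le 4)))
  · exact mul_le_mul_of_nonneg_right hCh' (sq_nonneg _)

end RRS2016

end Literature.Analysis.FluidPDE
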